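import Literature.Probability.RandomPlanarGeometry.SAWEdgeSetGeometry
import Literature.Probability.RandomPlanarGeometry.SAWReflect
import Literature.Probability.RandomPlanarGeometry.SAWPolygonSurgery
import HarnessLib

/-!
# Wide self-avoiding polygons on `ℤ²`: `SAP_m` up to translation and the set `WSAP^u_m`

Topic `Literature/Probability/RandomPlanarGeometry` (continues `SAWEdgeSetGeometry.lean`: `vertsOf`,
`HasWidthGe`/`HasHeightLe`/`HasLWidthGe`, `IsNormal`, `normalise`; `SupercriticalSAWPolygons.lean`:
the model `IsPolygon G E` of a self-avoiding polygon as the edge set of a cycle, Madras–Slade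
Def. 3.2.1, with `isPolygon_shiftEdges`; `SAWPolygonSurgery.lean`: opening a polygon at an edge;
`SAWReflect.lean`: the lattice reflections `Zd.reflAt k c`).

Source: H. Duminil-Copin, S. Ganguly, A. Hammond, I. Manolescu, *Bounding the number of
self-avoiding walks: Hammersley–Welsh with polygon insertion*, Ann. Probab. 48 (2020),
arXiv:1809.00760, §3.1 "Wide polygons": "Let `m ∈ 2ℕ` and `u ∈ ℕ`. We define the wide polygon set
`WSAP^u_m = {p ∈ SAP_m : lwidth(p) ≥ u, height(p) ≤ 16u}`", `SAP_m` being the `m`-step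
self-avoiding polygons of `ℤ²` up to translation (§1.1).

## Contents (namespace `Literature.Probability.RandomPlanarGeometry.SAW`)

* `reflEdges K E` — the image under the reflection `x₀ ↦ K − x₀` (`Zd.reflAt 0 K`): a polygon goes
  to a polygon (`isPolygon_reflEdges`); vertices / cardinality / width / height / line-width are
  preserved; `reflEdges_shiftEdges`, `normalise_reflEdges_shiftEdges` (reflections of translates
  normalise to `normalise (reflEdges 0 E)`).
* `IsPolygon.exists_two_edges` — every vertex of a polygon has two distinct polygon neighbours;
  `abs_sub_le_card_of_isPolygon` — two vertices of an `m`-gon differ by `≤ m` in each coordinate;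
  `coord_mem_Icc_of_isNormal` — a normal `m`-gon lives in `[0, m]²`.
* `normPolygons m` — the FINSET of normal `m`-edge self-avoiding polygons (= `SAP_m` up to
  translation), with `mem_normPolygons` (the ambient box is automatic).
* `widePolygons u m` — **`WSAP^u_m`**, with `mem_widePolygons`, `widePolygons_subset`.

## Design choices / not here

* The source fixes a particular rooting of wide polygons (line-width realised at height `0`, origin
  = leftmost point at height `0`) to biject classes with walks; here classes are NORMAL edge sets,
  which is all the counting statements need.
* NOT here: the join of two polygons (DGHM Lemma 3.3, second half) — `SAWWidePolygonsJoin.lean`.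
-/

noncomputable section

open Finset SimpleGraph Literature.Probability.LatticeModels Literature.Probability.Percolation
open Literature.Barriers.CriticalPhenomena.SupercriticalSAW (shiftEdges isPolygon_shiftEdges
  card_shiftEdges mem_shiftEdges_iff shiftEdges_injective)
open Literature.Probability.Percolation.SiteGadgetSystem (vertsOf mem_vertsOf)

namespace Literature.Probability.RandomPlanarGeometry.SAW

/-! ### Reflection in a vertical axis -/

/-- The image of an edge set under the reflection `x₀ ↦ K − x₀` of `ℤ²`.
[cite: DuminilCopinGangulyHammondManolescu2020, §3.1 (proof of Lemma 3.3: the reflection τ in the vertical axis)] -/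
def reflEdges (K : ℤ) (E : Finset (Sym2 (Site 2))) : Finset (Sym2 (Site 2)) :=
  E.image (Sym2.map (Zd.reflAt 0 K))

/-- Membership in a reflected edge set.
[cite: DuminilCopinGangulyHammondManolescu2020, §3.1 (proof of Lemma 3.3: the reflection τ in the vertical axis)] -/
theorem mem_reflEdges_iff {K : ℤ} {E : Finset (Sym2 (Site 2))} {e : Sym2 (Site 2)} :
    e ∈ reflEdges K E ↔ ∃ e' ∈ E, Sym2.map (Zd.reflAt 0 K) e' = e := by
  rw [reflEdges, Finset.mem_image]

/-- The vertices of a reflected edge set are the reflected vertices.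
[cite: DuminilCopinGangulyHammondManolescu2020, §3.1 (proof of Lemma 3.3: the reflection τ in the vertical axis)] -/
theorem mem_vertsOf_reflEdges {K : ℤ} {E : Finset (Sym2 (Site 2))} {v : Site 2} :
    v ∈ vertsOf (reflEdges K E) ↔ Zd.reflAt 0 K v ∈ vertsOf E := by
  simp only [mem_vertsOf, mem_reflEdges_iff]
  constructor
  · rintro ⟨e, ⟨e', he', rfl⟩, hv⟩
    refine ⟨e', he', ?_⟩
    induction e' using Sym2.ind with
    | _ a b =>
      simp only [Sym2.map_mk, Sym2.mem_iff] at hv ⊢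
      rcases hv with rfl | rfl <;> simp
  · rintro ⟨e', he', hv⟩
    refine ⟨Sym2.map (Zd.reflAt 0 K) e', ⟨e', he', rfl⟩, ?_⟩
    induction e' using Sym2.ind with
    | _ a b =>
      simp only [Sym2.map_mk, Sym2.mem_iff] at hv ⊢
      rcases hv with h | h
      · exact Or.inl (by rw [← h, Zd.reflAt_reflAt])
      · exact Or.inr (by rw [← h, Zd.reflAt_reflAt])

/-- Reflecting twice is the identity.
[cite: DuminilCopinGangulyHammondManolescu2020, §3.1 (proof of Lemma 3.3: the reflection τ in the vertical axis)] -/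
theorem reflEdges_reflEdges (K : ℤ) (E : Finset (Sym2 (Site 2))) : reflEdges K (reflEdges K E) = E := by
  rw [reflEdges, reflEdges, Finset.image_image]
  have : Sym2.map (Zd.reflAt (d := 2) 0 K) ∘ Sym2.map (Zd.reflAt 0 K) = id := by
    funext e; simp [Sym2.map_map, Zd.reflAt_reflAt]
  rw [this, Finset.image_id]

/-- Reflection preserves the number of edges.
[cite: DuminilCopinGangulyHammondManolescu2020, §3.1 (proof of Lemma 3.3: the reflection τ in the vertical axis)] -/
theorem card_reflEdges (K : ℤ) (E : Finset (Sym2 (Site 2))) : (reflEdges K E).card = E.card :=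
  Finset.card_image_of_injective _ (Sym2.map.injective (Zd.reflAt_injective 0 K))

/-- The reflection `x₀ ↦ K − x₀` as a graph homomorphism of `ℤ²`.
[cite: DuminilCopinGangulyHammondManolescu2020, §3.1 (proof of Lemma 3.3: the reflection τ in the vertical axis)] -/
def reflHom (K : ℤ) : zdGraph 2 →g zdGraph 2 where
  toFun := Zd.reflAt 0 K
  map_rel' h := Zd.zdGraph_adj_reflAt_of_adj 0 K h

/-- A reflected polygon is a polygon.
[cite: DuminilCopinGangulyHammondManolescu2020, §3.1 (proof of Lemma 3.3: the reflection τ in the vertical axis)] -/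
theorem isPolygon_reflEdges {E : Finset (Sym2 (Site 2))} (hE : IsPolygon (zdGraph 2) E) (K : ℤ) :
    IsPolygon (zdGraph 2) (reflEdges K E) := by
  classical
  obtain ⟨u, w, hw, rfl⟩ := hE
  refine ⟨_, w.map (reflHom K), hw.map (Zd.reflAt_injective 0 K), ?_⟩
  rw [Walk.edges_map]
  ext e
  simp only [List.mem_toFinset, List.mem_map, reflEdges, Finset.mem_image]
  rfl

/-- Two sites of `ℤ²` with equal coordinates are equal. [folklore] -/
private theorem site_ext₂ {v w : Site 2} (h0 : v 0 = w 0) (h1 : v 1 = w 1) : v = w := by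
  funext i; fin_cases i <;> assumption

/-- `reflAt 0 K (w + t) = reflAt 0 0 w + (K − t₀, t₁)`.
[cite: DuminilCopinGangulyHammondManolescu2020, §3.1 (proof of Lemma 3.3: the reflection τ in the vertical axis)] -/
theorem reflAt_add (K : ℤ) (w t : Site 2) :
    Zd.reflAt 0 K (w + t) = Zd.reflAt 0 0 w + siteXY (K - t 0) (t 1) := by
  refine site_ext₂ ?_ ?_
  · simp only [Zd.reflAt_apply_same, Pi.add_apply, mkSite_zero]; ring
  · rw [Zd.reflAt_apply_of_ne (by decide), Pi.add_apply, Pi.add_apply,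
      Zd.reflAt_apply_of_ne (by decide), mkSite_one]

/-- Reflection turns a translate into a translate of the reflection through the origin column.
[cite: DuminilCopinGangulyHammondManolescu2020, §3.1 (proof of Lemma 3.3: the reflection τ in the vertical axis)] -/
theorem reflEdges_shiftEdges (K : ℤ) (t : Site 2) (E : Finset (Sym2 (Site 2))) :
    reflEdges K (shiftEdges t E) = shiftEdges (siteXY (K - t 0) (t 1)) (reflEdges 0 E) := by
  ext e
  simp only [mem_reflEdges_iff, mem_shiftEdges_iff]
  constructor
  · rintro ⟨e₁, ⟨e₂, he₂, rfl⟩, rfl⟩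
    refine ⟨Sym2.map (Zd.reflAt 0 0) e₂, ⟨e₂, he₂, rfl⟩, ?_⟩
    rw [Sym2.map_map, Sym2.map_map]; congr 1; funext w; exact (reflAt_add K w t).symm
  · rintro ⟨e₁, ⟨e₂, he₂, rfl⟩, rfl⟩
    refine ⟨Sym2.map (fun w => w + t) e₂, ⟨e₂, he₂, rfl⟩, ?_⟩
    rw [Sym2.map_map, Sym2.map_map]; congr 1; funext w; exact reflAt_add K w t

/-- Every reflection is a translate of the reflection through the origin column.
[cite: DuminilCopinGangulyHammondManolescu2020, §3.1 (proof of Lemma 3.3: the reflection τ in the vertical axis)] -/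
theorem reflEdges_eq_shiftEdges_reflEdges_zero (K : ℤ) (E : Finset (Sym2 (Site 2))) :
    reflEdges K E = shiftEdges (siteXY K 0) (reflEdges 0 E) := by
  have := reflEdges_shiftEdges K 0 E
  rwa [shiftEdges_zero, Pi.zero_apply, Pi.zero_apply, sub_zero] at this

/-- Normalisation sees all reflections of all translates as one class.
[cite: DuminilCopinGangulyHammondManolescu2020, §3.1 (proof of Lemma 3.3: the reflection τ in the vertical axis)] -/
theorem normalise_reflEdges_shiftEdges (K : ℤ) (t : Site 2) (E : Finset (Sym2 (Site 2))) :
    normalise (reflEdges K (shiftEdges t E)) = normalise (reflEdges 0 E) := by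
  rw [reflEdges_shiftEdges, normalise_shiftEdges]

/-- Normalisation sees all reflections as one class.
[cite: DuminilCopinGangulyHammondManolescu2020, §3.1 (proof of Lemma 3.3: the reflection τ in the vertical axis)] -/
theorem normalise_reflEdges (K : ℤ) (E : Finset (Sym2 (Site 2))) :
    normalise (reflEdges K E) = normalise (reflEdges 0 E) := by
  rw [reflEdges_eq_shiftEdges_reflEdges_zero, normalise_shiftEdges]

/-- Height is reflection invariant.
[cite: DuminilCopinGangulyHammondManolescu2020, §3.1 (proof of Lemma 3.3: the reflection τ in the vertical axis)] -/
theorem hasHeightLe_reflEdges_iff {E : Finset (Sym2 (Site 2))} {K : ℤ} {h : ℕ} :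
    HasHeightLe (reflEdges K E) h ↔ HasHeightLe E h := by
  constructor
  · intro hE a ha b hb
    have := hE (Zd.reflAt 0 K a) (mem_vertsOf_reflEdges.2 (by rwa [Zd.reflAt_reflAt]))
      (Zd.reflAt 0 K b) (mem_vertsOf_reflEdges.2 (by rwa [Zd.reflAt_reflAt]))
    simpa [Zd.reflAt_apply_of_ne (show (1 : Fin 2) ≠ 0 by decide)] using this
  · intro hE a ha b hb
    have := hE _ (mem_vertsOf_reflEdges.1 ha) _ (mem_vertsOf_reflEdges.1 hb)
    simpa [Zd.reflAt_apply_of_ne (show (1 : Fin 2) ≠ 0 by decide)] using this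

/-- Line-width is reflection invariant.
[cite: DuminilCopinGangulyHammondManolescu2020, §3.1 (proof of Lemma 3.3: the reflection τ in the vertical axis)] -/
theorem hasLWidthGe_reflEdges_iff {E : Finset (Sym2 (Site 2))} {K : ℤ} {u : ℕ} :
    HasLWidthGe (reflEdges K E) u ↔ HasLWidthGe E u := by
  have key : ∀ (F : Finset (Sym2 (Site 2))), HasLWidthGe (reflEdges K F) u → HasLWidthGe F u := by
    rintro F ⟨a, ha, b, hb, hy, hab⟩
    refine ⟨Zd.reflAt 0 K b, mem_vertsOf_reflEdges.1 hb, Zd.reflAt 0 K a, mem_vertsOf_reflEdges.1 ha,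
      ?_, ?_⟩
    · simp [hy]
    · simp only [Zd.reflAt_apply_same]; linarith
  refine ⟨key E, fun hE => key (reflEdges K E) ?_⟩
  rwa [reflEdges_reflEdges]

/-- Width is reflection invariant.
[cite: DuminilCopinGangulyHammondManolescu2020, §3.1 (proof of Lemma 3.3: the reflection τ in the vertical axis)] -/
theorem hasWidthGe_reflEdges_iff {E : Finset (Sym2 (Site 2))} {K : ℤ} {w : ℕ} :
    HasWidthGe (reflEdges K E) w ↔ HasWidthGe E w := by
  have key : ∀ (F : Finset (Sym2 (Site 2))), HasWidthGe (reflEdges K F) w → HasWidthGe F w := by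
    rintro F ⟨a, ha, b, hb, hab⟩
    refine ⟨Zd.reflAt 0 K b, mem_vertsOf_reflEdges.1 hb, Zd.reflAt 0 K a, mem_vertsOf_reflEdges.1 ha, ?_⟩
    simp only [Zd.reflAt_apply_same]; linarith
  refine ⟨key E, fun hE => key (reflEdges K E) ?_⟩
  rwa [reflEdges_reflEdges]

/-! ### Polygons: vertices, degree two, coordinate bounds -/

section Generic

variable {V : Type*} [DecidableEq V] {G : SimpleGraph V}

/-- Every vertex of a polygon has two distinct neighbours along the polygon.
[cite: MadrasSlade1993, Definition 3.2.1 (self-avoiding polygons)] -/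
theorem IsPolygon.exists_two_edges {E : Finset (Sym2 V)} (hE : IsPolygon G E) {a : V}
    (ha : ∃ e ∈ E, a ∈ e) :
    ∃ b₁ b₂ : V, b₁ ≠ b₂ ∧ s(a, b₁) ∈ E ∧ s(a, b₂) ∈ E ∧ G.Adj a b₁ ∧ G.Adj a b₂ := by
  obtain ⟨e, he, hae⟩ := ha
  -- the edge through `a` is `s(a, b₁)`
  obtain ⟨b₁, hb₁⟩ : ∃ b₁, e = s(a, b₁) := by
    induction e using Sym2.ind with
    | _ x y =>
      rcases Sym2.mem_iff.1 hae with rfl | rfl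
      · exact ⟨y, rfl⟩
      · exact ⟨x, Sym2.eq_swap⟩
  subst hb₁
  have hEdge : ∀ {x y : V}, s(x, y) ∈ E → G.Adj x y := by
    intro x y hxy
    obtain ⟨u, c, -, rfl⟩ := hE
    exact Walk.adj_of_mem_edges _ (List.mem_toFinset.1 hxy)
  obtain ⟨P, hP, hPe, -, hPl, -⟩ := hE.exists_isPath_erase he
  -- `#E ≥ 3`, so `P` has length `≥ 2` and a first edge `s(a, b₂) ≠ s(a, b₁)`
  have h3 : 3 ≤ E.card := by
    obtain ⟨u, c, hc, rfl⟩ := hE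
    rw [List.toFinset_card_of_nodup hc.edges_nodup, Walk.length_edges]
    exact hc.three_le_length
  cases P with
  | nil => simp at hPl; omega
  | cons h P' =>
    rename_i b₂
    have hmem : s(a, b₂) ∈ E.erase s(a, b₁) := by
      rw [← hPe, List.mem_toFinset, Walk.edges_cons]; exact List.mem_cons_self
    obtain ⟨hne, hmemE⟩ := Finset.mem_erase.1 hmem
    refine ⟨b₁, b₂, fun h12 => hne (by rw [h12]), he, hmemE, hEdge he, h⟩

/-- Along a walk of `ℤ²`-type lattices: every vertex of the walk is within `length` of the
endpoint in each coordinate.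
[cite: MadrasSlade1993, Definition 3.2.1 (self-avoiding polygons)] -/
theorem abs_sub_le_length_of_mem_support {u v : Site 2} (p : (zdGraph 2).Walk u v) (i : Fin 2) :
    ∀ w ∈ p.support, |v i - w i| ≤ p.length := by
  induction p with
  | nil => intro w hw; simp only [Walk.support_nil, List.mem_singleton] at hw; subst hw; simp
  | cons h q ih =>
    rename_i x y z
    intro w hw
    rw [Walk.support_cons, List.mem_cons] at hw
    rw [Walk.length_cons, Nat.cast_add, Nat.cast_one]
    rcases hw with rfl | hw
    · have h1 := ih _ q.start_mem_support
      have h2 := Zd.abs_sub_le_one_of_adj h i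
      calc |z i - w i| = |(z i - y i) + (y i - w i)| := by ring_nf
        _ ≤ |z i - y i| + |y i - w i| := abs_add_le _ _
        _ ≤ q.length + 1 := add_le_add h1 h2
    · exact (ih _ hw).trans (by linarith)

end Generic

/-- The vertices of a polygon are the vertices of any of its cycles.
[cite: MadrasSlade1993, Definition 3.2.1 (self-avoiding polygons)] -/
theorem mem_vertsOf_iff_mem_support {u : Site 2} {c : (zdGraph 2).Walk u u} (hc : c.IsCycle)
    {v : Site 2} : v ∈ vertsOf c.edges.toFinset ↔ v ∈ c.support := by
  rw [mem_vertsOf, Walk.mem_support_iff_exists_mem_edges_of_not_nil hc.not_nil]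
  simp only [List.mem_toFinset]

/-- Two vertices of an `m`-edge polygon of `ℤ²` differ by at most `m` in each coordinate.
[cite: MadrasSlade1993, Definition 3.2.1 (self-avoiding polygons)] -/
theorem abs_sub_le_card_of_isPolygon {E : Finset (Sym2 (Site 2))} (hE : IsPolygon (zdGraph 2) E)
    {v w : Site 2} (hv : v ∈ vertsOf E) (hw : w ∈ vertsOf E) (i : Fin 2) :
    |v i - w i| ≤ E.card := by
  classical
  obtain ⟨u, c, hc, rfl⟩ := hE
  have hlen : (c.length : ℤ) = (c.edges.toFinset.card : ℤ) := by
    rw [List.toFinset_card_of_nodup hc.edges_nodup, Walk.length_edges]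
  rw [← hlen]
  have hv' := (mem_vertsOf_iff_mem_support hc).1 hv
  have hw' := (mem_vertsOf_iff_mem_support hc).1 hw
  -- `w` is on the part of `c` before `v` or on the part after `v`
  have hspec := c.take_spec hv'
  have hw'' : w ∈ ((c.takeUntil v hv').append (c.dropUntil v hv')).support := by rwa [hspec]
  rw [Walk.mem_support_append_iff] at hw''
  rcases hw'' with h | h
  · exact (abs_sub_le_length_of_mem_support _ i _ h).trans
      (by exact_mod_cast c.length_takeUntil_le_length hv')
  · have h' : w ∈ (c.dropUntil v hv').reverse.support := by
      rw [Walk.support_reverse]; exact List.mem_reverse.2 h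
    exact (abs_sub_le_length_of_mem_support _ i _ h').trans
      (by rw [Walk.length_reverse]; exact_mod_cast c.length_dropUntil_le_length hv')

/-- A NORMAL `m`-edge polygon has all its coordinates in `[0, m]`.
[cite: DuminilCopinGangulyHammondManolescu2020, §3.1 (polygons up to translation)] -/
theorem coord_mem_Icc_of_isNormal {E : Finset (Sym2 (Site 2))} (hE : IsPolygon (zdGraph 2) E)
    (hN : IsNormal E) {v : Site 2} (hv : v ∈ vertsOf E) (i : Fin 2) :
    0 ≤ v i ∧ v i ≤ E.card := by
  obtain ⟨hpos, ⟨a, ha, ha0⟩, ⟨b, hb, hb0⟩⟩ := hN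
  refine ⟨?_, ?_⟩
  · fin_cases i
    · exact (hpos v hv).1
    · exact (hpos v hv).2
  · fin_cases i
    · have := abs_sub_le_card_of_isPolygon hE hv ha 0
      rw [ha0, sub_zero] at this
      exact (le_abs_self _).trans this
    · have := abs_sub_le_card_of_isPolygon hE hv hb 1
      rw [hb0, sub_zero] at this
      exact (le_abs_self _).trans this

/-- The edges of a polygon are edges of the graph.
[cite: MadrasSlade1993, Definition 3.2.1 (self-avoiding polygons)] -/
theorem IsPolygon.mem_edgeSet {V : Type*} [DecidableEq V] {G : SimpleGraph V} {E : Finset (Sym2 V)}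
    (hE : IsPolygon G E) {e : Sym2 V} (he : e ∈ E) : e ∈ G.edgeSet := by
  obtain ⟨u, c, -, rfl⟩ := hE
  exact Walk.edges_subset_edgeSet _ (List.mem_toFinset.1 he)

/-- A normal `m`-edge polygon is made of edges of the box `[-m, m]²`.
[cite: DuminilCopinGangulyHammondManolescu2020, §3.1 (polygons up to translation)] -/
theorem subset_edgesIn_box_of_isNormal {E : Finset (Sym2 (Site 2))} (hE : IsPolygon (zdGraph 2) E)
    (hN : IsNormal E) : E ⊆ edgesIn (zdGraph 2) (box 2 E.card) := by
  intro e he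
  rw [mem_edgesIn_iff]
  refine ⟨hE.mem_edgeSet he, fun x hx => ?_⟩
  rw [mem_box]
  intro i
  have := coord_mem_Icc_of_isNormal hE hN (mem_verts_of_mem he hx) i
  constructor <;> linarith [this.1, this.2]

/-! ### `SAP_m` up to translation and `WSAP^u_m` as finsets -/

open Classical in
/-- The `m`-edge self-avoiding polygons of `ℤ²` in normal position — one representative of each
`m`-step self-avoiding polygon up to translation (`SAP_m` of the source; Madras–Slade's `p_m` is
its cardinality). [cite: DuminilCopinGangulyHammondManolescu2020, §1.1 (SAP_n: polygons up to translation)] -/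
def normPolygons (m : ℕ) : Finset (Finset (Sym2 (Site 2))) :=
  ((edgesIn (zdGraph 2) (box 2 m)).powerset).filter fun E => IsPolygon (zdGraph 2) E ∧ E.card = m ∧ IsNormal E

/-- Membership in `normPolygons m`: exactly the normal `m`-edge polygons (the ambient box is
automatic). [cite: DuminilCopinGangulyHammondManolescu2020, §1.1] -/
theorem mem_normPolygons {m : ℕ} {E : Finset (Sym2 (Site 2))} :
    E ∈ normPolygons m ↔ IsPolygon (zdGraph 2) E ∧ E.card = m ∧ IsNormal E := by
  classical
  rw [normPolygons, Finset.mem_filter, Finset.mem_powerset]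
  constructor
  · exact fun h => h.2
  · rintro ⟨hP, hc, hN⟩
    exact ⟨hc ▸ subset_edgesIn_box_of_isNormal hP hN, hP, hc, hN⟩

open Classical in
/-- **`WSAP^u_m`** — the wide polygon set of Duminil-Copin–Ganguly–Hammond–Manolescu: the `m`-step
self-avoiding polygons (up to translation, here: in normal position) with `lwidth ≥ u` and
`height ≤ 16u`. "Let `m ∈ 2ℕ` and `u ∈ ℕ`. We define the wide polygon set
`WSAP^u_m = {p ∈ SAP_m : lwidth(p) ≥ u, height(p) ≤ 16u}`."
[cite: DuminilCopinGangulyHammondManolescu2020, §3.1 (definition of WSAP)] -/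
def widePolygons (u m : ℕ) : Finset (Finset (Sym2 (Site 2))) :=
  (normPolygons m).filter fun E => HasLWidthGe E u ∧ HasHeightLe E (16 * u)

/-- Membership in `WSAP^u_m`. [cite: DuminilCopinGangulyHammondManolescu2020, §3.1] -/
theorem mem_widePolygons {u m : ℕ} {E : Finset (Sym2 (Site 2))} :
    E ∈ widePolygons u m ↔
      IsPolygon (zdGraph 2) E ∧ E.card = m ∧ IsNormal E ∧ HasLWidthGe E u ∧ HasHeightLe E (16 * u) := by
  classical
  rw [widePolygons, Finset.mem_filter, mem_normPolygons]
  tauto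

/-- `WSAP^u_m ⊆ SAP_m`. [cite: DuminilCopinGangulyHammondManolescu2020, §3.1] -/
theorem widePolygons_subset (u m : ℕ) : widePolygons u m ⊆ normPolygons m := by
  classical
  exact Finset.filter_subset _ _

end Literature.Probability.RandomPlanarGeometry.SAW
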